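import Summits.QuantumFields.QCD.Theses.PauliWegnerSea

/-!
# `GluonicCompletion` (crux stmt-QuantumFields-9152) — negative-side support: the threshold reading of
`QCDOf` and the finite model refuting "sign reweighting is bookkeeping"

Support lemmas extracted from the standing disprover's `Disproof.lean` (cdisprove g2), self-contained and
definition-free:
* `massiveBody_iff_threshold` (formerly `qcdOf_iff_threshold`, see the maintenance record) — audit g7's
  threshold reading of the PRE-RE-TYPE conjunct (`∃ reg, HasMassScaling ∧ ∀ m > 0 … ↔ ∃ M₀ ≥ 0, ∃ reg, … ∀ m > M₀ …`),
  cited as "not yet in the tree" by routes HeavyThresholdBridge, QuarkMassMonotone, CounterexampleMustBeHot,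
  CentreStabilisedCircle, AdaptiveBlockFermions; proved by shifting the flavour-blind critical mass
  `m_crit(k) ↦ m_crit(k) + a_k M₀ / Z_m(k)`, which changes neither `HasMassScaling` nor the scheme at the
  shifted masses (`scheme_mcrit_shift`).
* `reweighting_not_bookkeeping` — four-point model: sign average `½`, phase-quenched mean `0`, signed mean
  `−‖X‖∞`: a bound on `‖⟨Y⟩₊‖` plus sign coherence `≥ ½` (clause (iv) of the crux's hypothesis) bounds
  nothing signed, so the informal step "reweighting `⟨·σ⟩_{|w|}/⟨σ⟩_{|w|}`" needs the modulus INSIDE the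
  gauge integral (or a joint clustering input).

Maintenance record (full-build repair, 2026-08-17; dependency drift). The summit conjunct `QCDOf N_f` was
RE-TYPED on 2026-08-16 (statement re-type p117723, semantic-vacuity audit §4 item 7): it now conjoins
`reg.IsChiralAtZero` (the lattice gap closes as `m → 0⁺`), precisely to break the shift symmetry that
`qcdOf_iff_threshold` exhibited — the re-typed Statement's docstrings cite this lemma as the reason. Against
the re-typed `QCDOf` the old statement `QCDOf N_f ↔ ∃ M₀ ≥ 0, ∃ reg, HasMassScaling ∧ ∀ m > M₀ …` no longer
elaborates (49:32, 51:87) and its `←` direction is no longer true as bookkeeping (an up-shifted witness is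
chiral at zero only if the original regularisation is gapless above `M₀`:
`RobustYangMillsHandover.Negative.not_isChiralAtZero_mcrit_shift_of_uniformGapAbove`). Theorems files are
append-only, so nothing is mutated in place: the still-valid content — the shift symmetry of the pre-re-type
BODY, `QCDOf` unfolded to its former definiens — is added as `massiveBody_iff_threshold` (same proof), and
`qcdOf_iff_threshold` is kept as a `@[deprecated]` alias of it. The re-typed two-sided reading (offset
absorbed only together with chirality of the original regularisation above `M₀`) is the landed
`ChiralGluonicCompletion.Negative.qcdOf_iff_chiralThreshold`; the surviving direction `QCDOf → threshold form`
is `RobustYangMillsHandover.Negative.qcdOf_imp_aboveThreshold`. `scheme_mcrit_shift` and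
`reweighting_not_bookkeeping` are unchanged.
-/

noncomputable section

namespace Summit.QuantumFields.QCD.Theorems.GluonicCompletion.Negative

open Filter Literature.MathematicalPhysics.QuantumFieldTheory

variable {Nf : ℕ}

/-- Shifting the flavour-blind critical mass by `a_k M₀ / Z_m(k)` and running at masses `m` gives the SAME
scheme as running the original regularisation at masses `M₀ + m`. [folklore] -/
theorem scheme_mcrit_shift (reg : QCDRegularisation Nf) (M₀ : ℝ) (m : Fin Nf → ℝ)
    (z shift : QCDField Nf → ℕ → ℝ) :
    ({ reg with mcrit := fun k => reg.mcrit k + reg.a k * M₀ / reg.Zm k } : QCDRegularisation Nf).scheme m z shift =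
      reg.scheme (fun f => M₀ + m f) z shift := by
  simp only [QCDRegularisation.scheme, QCDScheme.mk.injEq, true_and, and_true]
  funext f k
  ring

/-- **The threshold reading of the pre-re-type massive-QCD body** (audit g7; until the statement re-type of
2026-08-16 the left side WAS `QCDOf N_f`, now it is `QCDOf N_f` minus its conjunct `reg.IsChiralAtZero`): to have
ONE mass-scaling regularisation carrying massive QCD with a gap at EVERY positive mass tuple it suffices to produce
the conclusion for all mass tuples above a witness-dependent common offset `M₀ ≥ 0` — shift `m_crit` by
`a_k M₀ / Z_m(k)`, which changes neither `HasMassScaling` (it does not mention `m_crit`) nor the scheme at the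
shifted masses (`scheme_mcrit_shift`). This is the semantic vacuity "`∀ m > 0 ≡ ∀ m > M₀`" that the re-type
removed by pinning the offset to the chiral point. [folklore] -/
theorem massiveBody_iff_threshold (Nf : ℕ) :
    (∃ reg : QCDRegularisation Nf, reg.HasMassScaling ∧ ∀ m : Fin Nf → ℝ, (∀ f, 0 < m f) →
      ∃ (z shift : QCDField Nf → ℕ → ℝ) (T : OSData (QCDField Nf) 4),
        IsQCDAlong (reg.scheme m z shift) T ∧ T.IsNontrivial QCDField.glue ∧ T.IsNonGaussian QCDField.glue ∧
          (∀ f g : Fin Nf, f ≠ g → T.IsNontrivial (QCDField.pseudoRe f g)) ∧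
            ∃ Δ > 0, T.HasMassGap Δ ∧ (reg.scheme m z shift).HasLatticeMassGap Δ) ↔
    ∃ M₀ : ℝ, 0 ≤ M₀ ∧ ∃ reg : QCDRegularisation Nf,
    reg.HasMassScaling ∧ ∀ m : Fin Nf → ℝ, (∀ f, M₀ < m f) →
      ∃ (z shift : QCDField Nf → ℕ → ℝ) (T : OSData (QCDField Nf) 4),
        IsQCDAlong (reg.scheme m z shift) T ∧ T.IsNontrivial QCDField.glue ∧ T.IsNonGaussian QCDField.glue ∧
          (∀ f g : Fin Nf, f ≠ g → T.IsNontrivial (QCDField.pseudoRe f g)) ∧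
            ∃ Δ > 0, T.HasMassGap Δ ∧ (reg.scheme m z shift).HasLatticeMassGap Δ := by
  constructor
  · rintro ⟨reg, hMS, h⟩
    exact ⟨0, le_rfl, reg, hMS, h⟩
  · rintro ⟨M₀, -, reg, hMS, h⟩
    refine ⟨{ reg with mcrit := fun k => reg.mcrit k + reg.a k * M₀ / reg.Zm k }, hMS, fun m hm => ?_⟩
    obtain ⟨z, shift, T, hQ, hN, hG, hP, Δ, hΔ, hT, hL⟩ :=
      h (fun f => M₀ + m f) (fun f => by linarith [hm f])
    refine ⟨z, shift, T, ?_, hN, hG, hP, Δ, hΔ, hT, ?_⟩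
    · rwa [scheme_mcrit_shift]
    · rwa [scheme_mcrit_shift]

/-- Deprecated spelling (landed p69682): the original statement read `QCDOf N_f ↔ ∃ M₀ ≥ 0, ∃ reg,
HasMassScaling ∧ ∀ m > M₀ …` — the threshold reading of the PRE-RE-TYPE conjunct. Since the statement re-type
of 2026-08-16 (`QCDOf` conjoins `reg.IsChiralAtZero`, introduced precisely to break this symmetry) that
biconditional neither elaborates nor holds as bookkeeping; the name is kept (append-only) as an alias of
`massiveBody_iff_threshold`, the same equivalence with `QCDOf N_f` unfolded to its former definiens. For the
re-typed conjunct use `ChiralGluonicCompletion.Negative.qcdOf_iff_chiralThreshold` (two-sided, chiral) or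
`RobustYangMillsHandover.Negative.qcdOf_imp_aboveThreshold` (the surviving direction). -/
@[deprecated massiveBody_iff_threshold (since := "2026-08-17")]
alias qcdOf_iff_threshold := massiveBody_iff_threshold

/-- **Refuted natural lemma (finite model): sign coherence `≥ ½` and a vanishing phase-quenched mean do
NOT bound the signed mean.** `W = (−1, 1, 1, 1)`, `X = (1, −⅓, −⅓, −⅓)`: `⟨W⟩₊ = ½`, `⟨X⟩₊ = 0`,
`⟨WX⟩₊/⟨W⟩₊ = −1 = −‖X‖∞`. [folklore] -/
theorem reweighting_not_bookkeeping :
    ∃ (W X : Fin 4 → ℝ), (∀ i, W i = 1 ∨ W i = -1) ∧ (∀ i, |X i| ≤ 1) ∧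
      (∑ i, W i) / 4 = 1 / 2 ∧ (∑ i, X i) / 4 = 0 ∧ ((∑ i, W i * X i) / 4) / ((∑ i, W i) / 4) = -1 := by
  refine ⟨![-1, 1, 1, 1], ![1, -1 / 3, -1 / 3, -1 / 3], ?_, ?_, ?_, ?_, ?_⟩
  · intro i; fin_cases i <;> simp
  · intro i; fin_cases i <;> simp [abs_le] <;> norm_num
  · simp [Fin.sum_univ_four]; norm_num
  · simp [Fin.sum_univ_four]; norm_num
  · simp [Fin.sum_univ_four]; norm_num

end Summit.QuantumFields.QCD.Theorems.GluonicCompletion.Negative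

end
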